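import Summits.BirchSwinnertonDyer.BirchSwinnertonDyer.Theses.TameQuarticManinParity
import Summits.BirchSwinnertonDyer.BirchSwinnertonDyer.Theorems.TameQuarticManinParityTwistPairAtThree
import Summits.BirchSwinnertonDyer.Rank1Residual.O6.X3WildOfKMCTorsionFreeMember
import Summits.BirchSwinnertonDyer.Rank1Residual.Additive.GordKodairaType
import Summits.BirchSwinnertonDyer.Rank1Residual.Additive.X4ExoticWild
import Literature.NumberTheory.EllipticCurves.IsogenyNeronScalingMinimalDiscriminantDirectionProofs
import Literature.NumberTheory.EllipticCurves.IsogenyOddKernelFourthPowerProofs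
import Literature.NumberTheory.EllipticCurves.IsogenyComplexUniformizationProofs
import Literature.NumberTheory.EllipticCurves.IsogenyRealPeriodProofs
import Literature.NumberTheory.EllipticCurves.IsogenyMultiplierDegreeProofs
import Literature.NumberTheory.EllipticCurves.NeronIsogenyScalingHoldsProofs
import Literature.NumberTheory.EllipticCurves.ModularCurveNeronLatticeProofs
import Literature.NumberTheory.EllipticCurves.OpenImageMazurProofs
import Literature.NumberTheory.EllipticCurves.IsogenyQuotientCurveProofs
import Literature.NumberTheory.EllipticCurves.IsogenyVariableChangeProofs
import Literature.NumberTheory.EllipticCurves.IsogenyCompProofs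
import Literature.NumberTheory.EllipticCurves.IsogenyDualProofs
import Literature.NumberTheory.EllipticCurves.GlobalMinimalModelProofs
import Literature.NumberTheory.EllipticCurves.SemistabilityDefectAtThreeTameWitnessProofs
import Literature.NumberTheory.EllipticCurves.SemistabilityDefectDiscriminantBoundProofs
import Literature.NumberTheory.DiophantineGeometry.ConductorExponentLeFiveProofs
import HarnessLib

/-!
# Route `TameQuarticManinParity`, LINE 20 (bsd-idea-3 g7), item F19 `TprimeRedNeronUnitForcesKodairaThree`
# (stmt-BirchSwinnertonDyer-27880) — PROVED BY NAME, OUTRIGHT: on a reducible (t′) row at `3`, if every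
# index-`3` Néron sublattice relation out of the optimal lattice has unit scalar, the curve is Kodaira III

Cell `pub/bsd-wall`, D-0145 line `route-BirchSwinnertonDyer-TeichmullerTwistDescent`, seat `bsd-line-ttd-p1` g9,
working the planner-of-record's TQMP LINE 20. BSD is NOT proved by this; Manin's conjecture is not proved by this;
E19/U19/K19 and the hard half stmt-24627 stay OPEN. With the glue G20 (stmt-27892, landed) this item makes E19 a
glued node (E19 ⟸ U19 ∧ F19), and with F19♭/G20♭ (landed) the route records U19 ⟺ E19.

## Proof (tree theorems only; no Gealy–Klagsbrun, no Kraus converse)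

(t′) at `3` is Kodaira III (`v₃Δ_min = 3`) or III* (`v₃Δ_min = 9`). Suppose III*. `W[3]` reducible gives a
`ℚ`-rational `3`-isogeny `φ : W → W₂` onto a globally minimal `W₂` (Mazur's stable line + the tree's quotient
isogeny + a global minimal model); its Néron scalar `n ∈ ℤ` on `(Λ(D), Λ_{W₂})` has index `deg φ = 3`
(Silverman VI.4.1(b), the tree's complex uniformisation of isogenies), so the hypothesis gives `3 ∤ n`. Then:
`v₂ := v₃Δ_min(W₂) ≥ 9` (orientation, DROP clause: `v₂ < 9 ⇒ 3 ∣ n`); `v₂ ≡ 3·9 ≡ 3 (mod 4)` (Dokchitser–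
Dokchitser parity for `3`-isogenies); `v₂ ≤ 13` (`W₂` additive potentially good at `3`: Ogg `v = f + m − 1`
with `f₃ ≤ 5` and `m ≤ 9`); and `3 ∣ v₂` (`W`, hence the `F`-isogenous `W₂`, has good reduction at the place
of ramification index `4` of the tame quartic witness `ℚ(3^{1/4})`, so `12 ∣ 4·v₂`). No integer satisfies all
four — so `W` is Kodaira III.

Design: theorems only; no definition, no named fact, no `sorry`; axioms `propext`, `Classical.choice`,
`Quot.sound`. References: [DokchitserDokchitser2015LocalInvariants] Thm. 5/6, Table 1; [GealyKlagsbrun2017]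
Thm. 1 (the statement's origin); [SilvermanAEC2009] VI.4.1(b), VII.5.5; [SilvermanATAEC1994] IV.9.4, IV.10.4,
IV.11.1; [FreitasKraus2022] §4; [Mazur1978] Thm. 1 (shape of the stable line).
-/

set_option autoImplicit false
-- D-0017: single-problem summit, so `Summit.BirchSwinnertonDyer.BirchSwinnertonDyer.…` repeats a namespace BY DESIGN.
set_option linter.dupNamespace false

noncomputable section

open scoped Classical NumberField

namespace Summit.BirchSwinnertonDyer.BirchSwinnertonDyer.Theorems.TameQuarticManinParity

open WeierstrassCurve IsDedekindDomain Rat.HeightOneSpectrum NumberField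
  Literature.NumberTheory.EllipticCurves Literature.NumberTheory.EllipticCurves.ModularForms
  Literature.NumberTheory.EllipticCurves.Rank1Residual
  Literature.NumberTheory.DiophantineGeometry
  Summit.BirchSwinnertonDyer.Rank1Residual Summit.BirchSwinnertonDyer.Rank1Residual.Additive
  Summit.BirchSwinnertonDyer.BirchSwinnertonDyer.Theses.TameQuarticManinParity

/-! ## §1 A `3`-isogeny onto a globally minimal curve, from a reducible `W[3]` -/

/-- **Reducible `W[3]` ⟹ a `ℚ`-isogeny of degree `3` onto a globally minimal curve**: Mazur's stable line
`C ⊂ W[3]` (`not_hasIrreducibleModPGaloisRep_iff_exists_natCard_eq`) is the kernel of the tree's quotient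
isogeny `W → W/C` (Silverman III.4.12), composed with the substitution isomorphism onto a global minimal model
(Néron). [cite: SilvermanAEC2009, Prop. III.4.12 and Cor. VIII.8.3] -/
theorem exists_isogeny_degree_three_of_not_hasIrreducibleModPGaloisRep (W : WeierstrassCurve ℚ)
    [W.IsElliptic] (hred : ¬ W.HasIrreducibleModPGaloisRep 3) :
    ∃ (W₂ : WeierstrassCurve ℚ) (_ : W₂.IsElliptic) (_ : W₂.IsGloballyMinimal) (φ : Isogeny W W₂),
      φ.degree = 3 := by
  haveI : NeZero ((3 : ℕ) : ℚ) := ⟨by norm_num⟩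
  obtain ⟨H, hHstab, hHcard⟩ :=
    (Mazur1978.not_hasIrreducibleModPGaloisRep_iff_exists_natCard_eq W 3).mp hred
  set S : AddSubgroup W.geomPoints := H.map (geomTorsion W (3 : ℤ)).subtype with hS
  have hScard : Nat.card S = 3 := by
    rw [← hHcard]
    exact Nat.card_congr (H.equivMapOfInjective _ (geomTorsion W (3 : ℤ)).subtype_injective).symm
  have hSfin : (S : Set W.geomPoints).Finite :=
    Nat.finite_of_card_ne_zero (hScard ▸ (by decide : (3 : ℕ) ≠ 0))
  have hSstab : ∀ (σ : Field.absoluteGaloisGroup ℚ) (P : W.geomPoints), P ∈ S → σ • P ∈ S := by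
    rintro σ P ⟨Q, hQ, rfl⟩
    exact ⟨σ • Q, hHstab σ Q hQ, rfl⟩
  obtain ⟨W', hW', g, -, hker, -, -⟩ := W.exists_isogeny_ker_eq_and_comp_eq_nsmul_holds S hSfin hSstab
  haveI := hW'
  obtain ⟨u, hmin⟩ := hasGlobalMinimalModel_rat_holds W'
  haveI : (u • W').IsGloballyMinimal := hmin
  refine ⟨u • W', inferInstance, hmin, (VariableChange.toIsogeny W' u).comp g, ?_⟩
  show Nat.card ((VariableChange.toIsogeny W' u).comp g).toAddMonoidHom.ker = 3
  rw [Isogeny.ker_comp, VariableChange.ker_toIsogeny, ← hScard, ← hker]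
  rfl

/-! ## §2 The Néron scalar of an isogeny on given Néron lattices, with index = degree -/

/-- **The Néron scalar of a `ℚ`-isogeny between globally minimal curves, on prescribed Néron period
pairs, with its index**: for `φ : W → W₂` and Néron period pairs `L, L₂` there is `n ∈ ℤ` with
`nΛ_W ⊆ Λ_{W₂}` and `[Λ_{W₂} : nΛ_W] = deg φ` (Silverman VI.4.1(b): `φ_ℂ(u z) = u₂(n z)`,
`#ker φ_ℂ = [Λ₂ : nΛ]`; `n ∈ ℚ` by Galois, `n ∈ ℤ` by the integral Néron scaling).
[cite: SilvermanAEC2009, Thm. VI.4.1(b)] [cite: SilvermanATAEC1994, IV.5.1 with IV.6.1 and Cor. IV.9.1] -/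
theorem exists_neronScaling_relIndex_eq_degree {W W₂ : WeierstrassCurve ℚ} [W.IsElliptic]
    [W₂.IsElliptic] [W.IsGloballyMinimal] [W₂.IsGloballyMinimal] (φ : Isogeny W W₂)
    {L L₂ : PeriodPair} (hL : IsNeronLatticeOf (W.baseChange ℂ) L)
    (hL₂ : IsNeronLatticeOf (W₂.baseChange ℂ) L₂) :
    ∃ n : ℤ, (∀ z ∈ L.lattice, (n : ℂ) * z ∈ L₂.lattice) ∧
      (L.lattice.toAddSubgroup.map (AddMonoidHom.mulLeft (n : ℂ))).relIndex L₂.lattice.toAddSubgroup =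
        φ.degree := by
  haveI : Algebra.IsAlgebraic ℚ (AlgebraicClosure ℚ) := AlgebraicClosure.isAlgebraic ℚ
  letI : Algebra (AlgebraicClosure ℚ) ℂ :=
    (IsAlgClosed.lift : AlgebraicClosure ℚ →ₐ[ℚ] ℂ).toRingHom.toAlgebra
  haveI : IsScalarTower ℚ (AlgebraicClosure ℚ) ℂ :=
    IsScalarTower.of_algebraMap_eq' (Subsingleton.elim _ _)
  obtain ⟨u₁, hker₁, -, hu₁⟩ := L.exists_addMonoidHom_of_g₂_g₃' hL.1 hL.2
  obtain ⟨u₂, hker₂, -, hu₂⟩ := L₂.exists_addMonoidHom_of_g₂_g₃' hL₂.1 hL₂.2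
  obtain ⟨α, hα0, hαΛ, happ, hcard⟩ :=
    φ.exists_mul_baseChange_apply_eq hL.1 hL.2 hL₂.1 hL₂.2 u₁ hker₁ hu₁ u₂ hker₂ hu₂
  obtain ⟨k, hk⟩ := φ.exists_algebraMap_eq_of_baseChange_apply_eq hL.1 hL.2 hL₂.1 hL₂.2 u₁ hker₁ hu₁
    u₂ hker₂ hu₂ happ
  have hkC : (k : ℂ) = α := by rw [← hk, eq_ratCast]
  have hle : ∀ z ∈ L.lattice, (k : ℂ) * z ∈ L₂.lattice := fun z hz ↦ by rw [hkC]; exact hαΛ z hz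
  obtain ⟨n, hn⟩ := integral_neronScaling_of_isGloballyMinimal_holds W W₂ L L₂ hL hL₂ k hle
  have hnC : (n : ℂ) = α := by rw [← hkC, ← hn]; push_cast; rfl
  refine ⟨n, fun z hz ↦ by rw [hnC]; exact hαΛ z hz, ?_⟩
  have hsub : L.lattice.toAddSubgroup.map (AddMonoidHom.mulLeft (n : ℂ)) =
      (L.mulLeft α hα0).lattice.toAddSubgroup := by
    ext z
    simp only [Submodule.mem_toAddSubgroup, PeriodPair.mem_mulLeft_lattice, AddSubgroup.mem_map,
      AddMonoidHom.coe_mulLeft, hnC]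
    constructor
    · rintro ⟨y, hy, rfl⟩
      rwa [inv_mul_cancel_left₀ hα0]
    · intro hz
      exact ⟨_, hz, by rw [mul_inv_cancel_left₀ hα0]⟩
  rw [hsub, ← hcard, Isogeny.natCard_ker_baseChange_eq_degree]

/-! ## §3 Two bounds on `v₃ Δ_min` of a partner -/

/-- **`v₃(Δ_min) ≤ 13` at an additive potentially good `3`** (Ogg's formula `v = f + m − 1` with
`f₃ ≤ 5` — Lockhart–Rosen–Silverman / Silverman *ATAEC* IV.10.4, the tree's
`conductorExponent_le_five_of_natGenerator_eq_three_holds` — and `m ≤ 9` for the potentially good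
Kodaira types; `Iₙ*`, `n ≥ 1`, is excluded by `0 ≤ v₃(j)`).
[cite: SilvermanATAEC1994, IV.10.4 and IV.11.1 with Table 4.1] -/
theorem padicValInt_minimalDiscriminantInt_le_thirteen_of_addv_three (V : WeierstrassCurve ℚ)
    [V.IsElliptic] [V.IsGloballyMinimal] (hadd : Addv V 3) (hj : 0 ≤ padicValRat 3 V.j) :
    padicValInt 3 V.minimalDiscriminantInt ≤ 13 := by
  haveI : PerfectField (IsLocalRing.ResidueField ((placeOf 3).adicCompletionIntegers ℚ)) :=
    PerfectField.ofFinite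
  have hf : V.conductorExponent (placeOf 3) ≤ 5 :=
    V.conductorExponent_le_five_of_natGenerator_eq_three_holds (placeOf 3) (natGenerator_placeOf_eq 3)
  have hk := isAdditive_kodairaSymbolAt_placeOf_of_addv V 3 hadd
  unfold WeierstrassCurve.conductorExponent at hf
  rw [ordMinimalDiscriminant_placeOf_eq V 3] at hf
  unfold WeierstrassCurve.numComponentsAt at hf
  rcases hks : V.kodairaSymbolAt (placeOf 3) with (_ | n) | _ | _ | _ | (_ | n) | _ | _ | _ <;>
    rw [hks] at hk hf
  · exact absurd rfl hk.1
  · exact absurd ⟨_, Nat.succ_ne_zero _, rfl⟩ hk.2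
  · simp only [KodairaSymbol.numComponents] at hf; omega
  · simp only [KodairaSymbol.numComponents] at hf; omega
  · simp only [KodairaSymbol.numComponents] at hf; omega
  · simp only [KodairaSymbol.numComponents] at hf; omega
  · exact absurd (padicValRat_j_neg_of_kodairaSymbolAt_eq_Istar_succ V hks) (not_lt.mpr hj)
  · simp only [KodairaSymbol.numComponents] at hf; omega
  · simp only [KodairaSymbol.numComponents] at hf; omega
  · simp only [KodairaSymbol.numComponents] at hf; omega

/-- Place bookkeeping: a place `w ∋ 3` of a number field lies over the place `(3)` of `ℤ`. [folklore] -/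
private theorem liesOver_placeOf_three {F : Type*} [Field F] (w : HeightOneSpectrum (𝓞 F))
    (hw : ((3 : ℕ) : 𝓞 F) ∈ w.asIdeal) : w.asIdeal.LiesOver (placeOf 3).asIdeal := by
  have hvspan : (placeOf 3).asIdeal = Ideal.span {((3 : ℕ) : ℤ)} := by
    rw [asIdeal_eq_span_natGenerator_int, natGenerator_placeOf_eq]
  have hle : (placeOf 3).asIdeal ≤ w.asIdeal.under ℤ := by
    rw [hvspan, Ideal.span_le, Set.singleton_subset_iff, SetLike.mem_coe, Ideal.under_def,
      Ideal.mem_comap, map_natCast]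
    exact hw
  exact ⟨(((placeOf 3).isMaximal.eq_of_le (Ideal.IsPrime.ne_top inferInstance) hle).symm).symm⟩

/-- **`3 ∣ v₃ Δ_min(W₂)` for every curve `W₂` isogenous INTO a Kodaira III / III* curve at `3`**: the tame
quartic witness (`ℚ(3^{1/4})`, a place `w` of ramification index `4` where `W` is semistable, hence good
since `v₃ j(W) ≥ 0`) also makes `W₂` good at `w` (isogeny invariance of good reduction, *AEC* VII.7.2), and
good reduction upstairs forces `12 ∣ e(w∣3)·v₃Δ_min(W₂) = 4·v₃Δ_min(W₂)`.
[cite: FreitasKraus2022, §4 first paragraph] [cite: SilvermanAEC2009, VII.5 Prop. 5.5 (proof) and Cor. VII.7.2] -/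
theorem three_dvd_padicValInt_minimalDiscriminantInt_of_isogeny_to_III
    (W W₂ : WeierstrassCurve ℚ) [W.IsElliptic] [W.IsGloballyMinimal] [W₂.IsElliptic] [W₂.IsGloballyMinimal]
    (hK : W.kodairaSymbolAt (placeOf 3) = .III ∨ W.kodairaSymbolAt (placeOf 3) = .IIIstar)
    (hj : 0 ≤ padicValRat 3 W.j) (ψ : Isogeny W₂ W) :
    3 ∣ padicValInt 3 W₂.minimalDiscriminantInt := by
  obtain ⟨F, _instF, _instNF, w, hw, hram, hss⟩ :=
    W.isSemistabilityWitnessAt_three_four_of_kodairaSymbolAt_eq_III_or_IIIstar (placeOf 3)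
      (natGenerator_placeOf_eq 3) hK
  haveI : w.asIdeal.LiesOver (placeOf 3).asIdeal := liesOver_placeOf_three w hw
  haveI := w.isPrime
  haveI := (placeOf 3).isMaximal
  -- `W_F` is good at `w` (semistable with integral `j`)
  have hjv : (placeOf 3).valuation ℚ W.j ≤ 1 := by
    by_cases hj0 : W.j = 0
    · rw [hj0, map_zero]; exact zero_le
    · rw [Rat.HeightOneSpectrum.valuation_eq_exp_neg_padicValRat (placeOf 3) hj0,
        natGenerator_placeOf_eq, ← WithZero.exp_zero, WithZero.exp_le_exp]
      linarith
  have hgW : (W.baseChange F).HasGoodReductionAt w :=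
    W.hasGoodReductionAt_baseChange_of_isSemistableAt_of_valuation_j_le_one F (v := placeOf 3)
      (w := w) hjv hss
  -- so is the `F`-isogenous `W₂`
  haveI : (W.baseChange F).IsElliptic := inferInstanceAs (W.map (algebraMap ℚ F)).IsElliptic
  haveI : (W₂.baseChange F).IsElliptic := inferInstanceAs (W₂.map (algebraMap ℚ F)).IsElliptic
  have hgW₂ : (W₂.baseChange F).HasGoodReductionAt w :=
    (ψ.extendScalars F).hasGoodReductionAt_of_hasGoodReductionAt hgW
  have h12 := W₂.twelve_dvd_ramificationIdx_mul_ordMinimalDiscriminant_of_hasGoodReductionAt_baseChange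
    F (v := placeOf 3) (w := w) hgW₂
  have he : (placeOf 3).asIdeal.ramificationIdx' w.asIdeal = 4 := by
    rw [Ideal.ramificationIdx'_eq_ramificationIdx (placeOf 3).asIdeal w.asIdeal (placeOf 3).ne_bot]
    exact hram
  rw [he, ordMinimalDiscriminant_placeOf_eq W₂ 3] at h12
  omega

/-! ## §4 F19 by name -/

/-- **F19 `TprimeRedNeronUnitForcesKodairaThree` (stmt-BirchSwinnertonDyer-27880), by name.** On the reducible
(t′) rows at `3`: if every index-`3` Néron sublattice relation `αΛ(D) ⊆ Λ_{W₂}` out of `W` has `3 ∤ α`, then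
`v₃Δ_min(W) = 3` (Kodaira III). Were `W` of type III* (`v = 9`), the `3`-isogeny `φ : W → W₂` of §1 with
Néron scalar `n`, `3 ∤ n` (§2 + the hypothesis), would have a partner with `9 ≤ v₃Δ_min(W₂) ≤ 13`,
`≡ 3 (mod 4)` and `≡ 0 (mod 3)` (orientation drop clause; Dokchitser–Dokchitser parity; §3) — no such integer.
[cite: DokchitserDokchitser2015LocalInvariants, Thm. 5, Thm. 6 and Table 1] [cite: GealyKlagsbrun2017, Thm. 1]
[cite: SilvermanAEC2009, Thm. VI.4.1(b)] [cite: SilvermanATAEC1994, IV.10.4 and IV.11.1] -/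
theorem tprimeRedNeronUnitForcesKodairaThree_proof : TprimeRedNeronUnitForcesKodairaThree := by
  intro W _ _ _ hcm hadd ht hred D hopt hmin hU
  rcases TwistPairAtThree.kodairaSymbolAt_and_padicValInt_of_subTprime W hadd ht with
    ⟨-, h3⟩ | ⟨hKstar, h9⟩
  · exact h3
  exfalso
  have hj : 0 ≤ padicValRat 3 W.j := not_lt.mp ht.1
  -- §1: a `3`-isogeny onto a globally minimal `W₂`
  obtain ⟨W₂, hE₂, hM₂, φ, hdeg3⟩ := exists_isogeny_degree_three_of_not_hasIrreducibleModPGaloisRep W hred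
  haveI := hE₂
  haveI := hM₂
  -- §2: its Néron scalar `n` on `(Λ(D), Λ_{W₂})`, of index `3`; the hypothesis gives `3 ∤ n`
  obtain ⟨L₂, hL₂⟩ := exists_isNeronLatticeOf_holds (W₂.baseChange ℂ)
  obtain ⟨n, hn, hidx⟩ := exists_neronScaling_relIndex_eq_degree φ D.isNeronLattice hL₂
  rw [hdeg3] at hidx
  have h3n : ¬ (3 : ℤ) ∣ n := hU W₂ L₂ n hL₂ hn hidx
  -- the four constraints on `v₂ = v₃ Δ_min(W₂)`
  have h9le : 9 ≤ padicValInt 3 W₂.minimalDiscriminantInt := by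
    by_contra hlt
    exact h3n (dvd_neronScaling_of_padicValInt_minimalDiscriminantInt_lt W W₂ Nat.prime_three D.L L₂
      D.isNeronLattice hL₂ n hn hj (by rw [h9]; omega))
  have hpar := φ.padicValInt_minimalDiscriminantInt_modEq_four_of_degree_eq_three hdeg3 3
  rw [h9, Int.modEq_iff_dvd] at hpar
  obtain ⟨m, hm⟩ := hpar
  obtain ⟨hadd₂, hj₂⟩ := Addv.of_isIsogenous_of_padicValRat_j_nonneg hadd hj ⟨φ⟩
  have h13 := padicValInt_minimalDiscriminantInt_le_thirteen_of_addv_three W₂ hadd₂ hj₂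
  obtain ⟨ψ, -⟩ := φ.exists_dual_of_isElliptic
  have h3dvd := three_dvd_padicValInt_minimalDiscriminantInt_of_isogeny_to_III W W₂ (Or.inr hKstar) hj ψ
  omega

end Summit.BirchSwinnertonDyer.BirchSwinnertonDyer.Theorems.TameQuarticManinParity

end
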